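import Summits.QuantumFields.YangMills.Theorems.FluctuationComparisonRegPrIntLOrganTangentGoodSetTailMeanShift
import Literature.Probability.Divergences.JensenGapVariance
import HarnessLib

/-!
# Route `UnitScaleTilt` — crux `FluctuationComparisonRegPrIntL` (stmt-QuantumFields-20520, rung R3), PATH-B organ: «THE GOOD-SET TAIL FROM ENDPOINT TAILS AND A PATH VARIANCE» —
# A5's tail clause for EVERY `t ∈ [0,1]` from the two endpoint tails and ONE variance letter `σ²` (SPEC (xv-b) «A5 TAIL THRESHOLD»; LEAD №68's bridge)

Cell `ym3-torus` (YM ladder rung R3 = continuum `SU(2)` Yang–Mills on the three-torus — a RUNG: NOT d = 4, NOT infinite volume, NOT a mass gap, NOT Clay).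
Width seat `ym-ust-20520-w4` (gen 26); the bridge NAMED AND SHAPED by LEAD `ym-ust-20520-w3` g28 №68 (owner of DISCHARGE-SPEC item (xv-b)); `--kind proof --supports
stmt-QuantumFields-20520 --as helper`, count-neutral, DEFINITION-FREE, no registry ∕ binder ∕ `Lines/` edit, default heartbeats, `autoImplicit false`.

WHAT.  ★★`setIntegral_wgt_le_of_endpointTails_pathVariance` — binders = ✓`…OrganTangentGoodSetTailAlongPath.setIntegral_wgt_le_max_mul_exp`'s VERBATIM (= those of
✓`wgt_normalised`, then `t ∈ [0,1]`, a window point `V`, a measurable fibre event `A`), then the three letters of the A5 slot: endpoint tails `ES₀, ES₁`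
(`∫_A ŵ₀ ≤ ES₀`, `∫_A ŵ₁ ≤ ES₁`, `0 ≤ ES₀`) and a PATH VARIANCE bound `σ²`:
  `hvar : ∀ u ∈ [0,1], ∫ ŵ_u(V,·)·(h − m_u)² dτ ≤ σ²`,  `h(z) = log ρ_Ts(Φ(V,z)) − log ρ′_Ts(Φ(V,z))`,  `m_u = ∫ ŵ_u(V,·)·h dτ`  (displayed as integrals);
conclusion = the `(hES, htail)` pair of the A5 door ✓p823618 `jtBracket_sq_of_hdisp_crude`, for EVERY `t ∈ [0,1]`:
  `0 ≤ max ES₀ ES₁ · exp(σ²∕4) ∧ ∫_A ŵ_t(V,·) dτ ≤ max ES₀ ES₁ · exp(σ²∕4)`.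
ROUTE (LEAD №68): the Jensen gaps `J₀` (of `h` under `ŵ₀`) and `J₁` (of `−h` under `ŵ₁`) of ✓p832596 satisfy `0 ≤ J₀, J₁ ≤ σ²∕2` by
✓`Literature.Probability.Divergences.weighted_jensenGap_nonneg_and_le` (`JensenGapVariance` §3: Taylor–Lagrange for the cgf — the `u·h`-tilt of `ŵ₀` IS `ŵ_u` and the
`u·(−h)`-tilt of `ŵ₁` IS `ŵ_{1−u}`, by ✓p832596 §1's pointwise identities — with the a.s. boundedness licence for `h` supplied by continuity of `log ρ − log ρ′` on the
compact `24∕25`-window carrying the χ-support); `J₀ + J₁ = m₁ − m₀` (px19 g24 ✓`…GoodSetTailMeanShift.gap_add_gap_eq_sub`), so `|m₁ − m₀| ≤ σ²`; then px19 g24's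
✓`setIntegral_wgt_le_of_endpointTails_meanShift` with `J♯ := σ²`.

WHY (DISCHARGE-SPEC v1.9–v1.11 §11 (xv-b); LEAD RULINGS №58∕№59; LEAD №60∕№63∕№68).  A5 asks `∫_{Goodᶜ} ŵ_t(Xw,·) dτ ≤ ES` for every `t`; print has only the two
endpoint (genuine conditional) fibre laws.  After ✓p832486∕✓p832596 (tilted-path event bound) and px19's mean-shift algebra, THIS file states the slot's supplier
shape in the organ's own currencies: two endpoint large-field tails ([Balaban1985UV3] (71)-type, print's) and ONE second-order letter — the variance of `h` along the
interpolated fibre laws (D4's connected-correlation currency) — NO sup-norm of `h` anywhere.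

HONEST FRAMING: [folklore] measure theory ∕ cgf calculus over the frame's HYPOTHESIS letters; nothing of Bałaban's analysis ((71) included) is asserted or proved;
(xv-b) is NOT discharged (`ES₀, ES₁, σ²` remain letters to be supplied); `SpreadFibreLawHJ(sq)`(ᴱ) ∕ `OrganDischargeInputsHJ(sq)` (every edition) UNDISCHARGED; the
five registered stubs of `Lines/runpair_organ.lean` (registry 3732b7df, untouched), crux 20520 and `YM3TorusSU2` are NOT proved; rung R3 = SU(2) YM₃ on T³ at fixed
lattice data — NOT d = 4, NOT infinite volume, NOT a mass gap, NOT Clay; the Yang–Mills mass gap is NOT proved.  Credit: LEAD w3 g28 (shape), px19 g24 (mean-shift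
door), px5 (Jensen lane), desk g48.
-/

set_option autoImplicit false

noncomputable section

namespace Summit.QuantumFields.YangMills.Theorems.OrganTangentGoodSetTailVariance

open MeasureTheory Filter Topology
open scoped ENNReal NNReal
open Literature.MathematicalPhysics.QuantumFieldTheory.Balaban1983to89 T3ContinuumYM3Torus T3NestedUnitLaws
  T3UnitLawDensityEML T4Continuum T3UnitScaleTilt T3LevelShift T3TiltDescent
open Summit.QuantumFields.YangMills.BalabanUVNodes.N09DomAltThresholdNull (isOpen_setOf_plaqSmall_SU)
open Literature.MathematicalPhysics.QuantumFieldTheory.Balaban1983to89.B12ContinuousTransportInvarianceOn (continuous_dist1_SU continuous_plaqHol_SU)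
open Summit.QuantumFields.YangMills.Theorems.FluctuationComparisonRegPrIntLRunpairOrganFibreLaw (mwCut wNum wgt)
open Summit.QuantumFields.YangMills.Theorems.OrganTangentFibreWeightNormalisation (wgt_normalised wNum_nonneg)
open Summit.QuantumFields.YangMills.Theorems.OrganTangentGoodSetTailAlongPath (wNum_eq_wNum_zero_mul_exp wNum_eq_wNum_one_mul_exp integrable_mwCut_mul_comp_mul)
open Summit.QuantumFields.YangMills.Theorems.OrganTangentGoodSetTailMeanShift (gap_add_gap_eq_sub setIntegral_wgt_le_of_endpointTails_meanShift)
open Literature.Probability.Divergences (weighted_jensenGap_nonneg_and_le)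

/-- ★★ **THE GOOD-SET TAIL FROM ENDPOINT TAILS AND A PATH VARIANCE** — in the frame's letters (binders of ✓`wgt_normalised`, then `t ∈ [0,1]`, a window point `V`,
a measurable fibre event `A`; then `ES₀ ES₁ σ2`): if `∫_A ŵ₀ ≤ ES₀`, `∫_A ŵ₁ ≤ ES₁` (`0 ≤ ES₀`) and the variance of `h = log ρ_Ts∘Φ(V,·) − log ρ′_Ts∘Φ(V,·)` under EVERY
interpolated fibre law `ŵ_u`, `u ∈ [0,1]`, is at most `σ2`, then for every `t ∈ [0,1]`:
`0 ≤ max ES₀ ES₁ · exp(σ2∕4) ∧ ∫_A ŵ_t(V,·) dτ ≤ max ES₀ ES₁ · exp(σ2∕4)` — the A5 door's `(hES, htail)` pair.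
[cite: BoucheronLugosiMassart2013, Lemma 2.2 p. 27] [cite: Rudin1987, Thm 3.3 p. 62 and Thm 3.5 p. 63] -/
theorem setIntegral_wgt_le_of_endpointTails_pathVariance (F : T3Family) (γ b₀ p₀ : ℝ) (j Ts : ℕ) (hjTs : j + 1 ≤ Ts)
    (ρ ρ' : (i : ℕ) → GaugeField (F.P i) 0 ↥(Matrix.specialUnitaryGroup (Fin 2) ℂ) → ℝ)
    (hρm : Measurable (ρ Ts)) (hρ'm : Measurable (ρ' Ts))
    (hρc : ContinuousOn (ρ Ts) {U | PlaqSmall (θBal F.L γ b₀ p₀ Ts) U}) (hρ'c : ContinuousOn (ρ' Ts) {U | PlaqSmall (θBal F.L γ b₀ p₀ Ts) U})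
    (hρpos : ∀ U, PlaqSmall (θBal F.L γ b₀ p₀ Ts) U → 0 < ρ Ts U ∧ 0 < ρ' Ts U)
    (hθ : 0 < θBal F.L γ b₀ p₀ Ts)
    (hχc : Continuous (mwCut F γ b₀ p₀ j Ts)) (hχ0 : ∀ U, 0 ≤ mwCut F γ b₀ p₀ j Ts U)
    (hχsupp : ∀ U, mwCut F γ b₀ p₀ j Ts U ≠ 0 → ∀ (n : ℕ) (hjn : j + 1 ≤ n) (hnK : n ≤ Ts), PlaqSmall (24 / 25 * θBal F.L γ b₀ p₀ n) (descendTo F ℰp n Ts hnK U))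
    (hχpos : ∀ U, (∀ (n : ℕ) (hjn : j + 1 ≤ n) (hnK : n ≤ Ts), PlaqSmall (24 / 25 * θBal F.L γ b₀ p₀ n) (descendTo F ℰp n Ts hnK U)) → 0 < mwCut F γ b₀ p₀ j Ts U)
    {Z : Type} [MeasurableSpace Z] (τ : Measure Z) [IsProbabilityMeasure τ]
    (Φ : GaugeField (F.P j) 0 ↥(Matrix.specialUnitaryGroup (Fin 2) ℂ) × Z → GaugeField (F.P Ts) 0 ↥(Matrix.specialUnitaryGroup (Fin 2) ℂ))
    (J : GaugeField (F.P j) 0 ↥(Matrix.specialUnitaryGroup (Fin 2) ℂ) × Z → ℝ≥0)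
    (hΦm : Measurable Φ) (hJm : Measurable J) (CJ : ℝ) (hJle : ∀ V z, (J (V, z) : ℝ) ≤ CJ)
    (hpos : ∀ V, PlaqSmall (θBal F.L γ b₀ p₀ j) V →
      0 < ∫⁻ z in {z | (∀ (n : ℕ) (hjn : j + 1 ≤ n) (hnK : n ≤ Ts), PlaqSmall (24 / 25 * θBal F.L γ b₀ p₀ n) (descendTo F ℰp n Ts hnK (Φ (V, z))))},
        (J (V, z) : ℝ≥0∞) ∂τ)
    (t : ℝ) (ht0 : 0 ≤ t) (ht1 : t ≤ 1)
    (V : GaugeField (F.P j) 0 ↥(Matrix.specialUnitaryGroup (Fin 2) ℂ)) (hV : PlaqSmall (θBal F.L γ b₀ p₀ j) V)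
    {A : Set Z} (hA : MeasurableSet A)
    {ES₀ ES₁ σ2 : ℝ} (hES₀ : 0 ≤ ES₀)
    (htail₀ : ∫ z in A, wgt F γ b₀ p₀ j Ts ρ ρ' τ Φ J 0 V z ∂τ ≤ ES₀)
    (htail₁ : ∫ z in A, wgt F γ b₀ p₀ j Ts ρ ρ' τ Φ J 1 V z ∂τ ≤ ES₁)
    (hvar : ∀ u ∈ Set.Icc (0 : ℝ) 1,
      ∫ z, wgt F γ b₀ p₀ j Ts ρ ρ' τ Φ J u V z *
          (Real.log (ρ Ts (Φ (V, z))) - Real.log (ρ' Ts (Φ (V, z)))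
            - ∫ x, wgt F γ b₀ p₀ j Ts ρ ρ' τ Φ J u V x * (Real.log (ρ Ts (Φ (V, x))) - Real.log (ρ' Ts (Φ (V, x)))) ∂τ) ^ 2 ∂τ ≤ σ2) :
    0 ≤ max ES₀ ES₁ * Real.exp (σ2 / 4) ∧
    ∫ z in A, wgt F γ b₀ p₀ j Ts ρ ρ' τ Φ J t V z ∂τ ≤ max ES₀ ES₁ * Real.exp (σ2 / 4) := by
  classical
  haveI : CompactSpace (GaugeField (F.P Ts) 0 ↥(Matrix.specialUnitaryGroup (Fin 2) ℂ)) :=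
    inferInstanceAs (CompactSpace (PBond (F.P Ts) 0 → ↥(Matrix.specialUnitaryGroup (Fin 2) ℂ)))
  haveI : BorelSpace (GaugeField (F.P Ts) 0 ↥(Matrix.specialUnitaryGroup (Fin 2) ℂ)) :=
    Literature.MathematicalPhysics.QuantumFieldTheory.Balaban1983to89.T3OrbitAverage.instBorelSpaceGaugeField
  -- the tilt
  set h : Z → ℝ := fun z => Real.log (ρ Ts (Φ (V, z))) - Real.log (ρ' Ts (Φ (V, z))) with hh
  -- frame facts
  have hN := wgt_normalised F γ b₀ p₀ j Ts hjTs ρ ρ' hρm hρ'm hρc hρ'c hρpos hθ hχc hχ0 hχsupp hχpos τ Φ J hΦm hJm CJ hJle hpos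
  have hnn := wNum_nonneg F γ b₀ p₀ j Ts hjTs ρ ρ' hρpos hθ hχ0 hχsupp Φ J
  obtain ⟨hI0, hP0, -, -⟩ := hN 0 V hV
  obtain ⟨hI1, hP1, -, -⟩ := hN 1 V hV
  -- pointwise path identities (✓p832596 §1)
  have hpt0 : ∀ (u : ℝ) (z : Z), wNum F γ b₀ p₀ j Ts ρ ρ' Φ J u V z = wNum F γ b₀ p₀ j Ts ρ ρ' Φ J 0 V z * Real.exp (u * h z) :=
    fun u z => wNum_eq_wNum_zero_mul_exp F γ b₀ p₀ j Ts hjTs ρ ρ' hρpos hθ hχsupp Φ J u V z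
  have hpt1 : ∀ (u : ℝ) (z : Z), wNum F γ b₀ p₀ j Ts ρ ρ' Φ J (1 - u) V z = wNum F γ b₀ p₀ j Ts ρ ρ' Φ J 1 V z * Real.exp (u * -h z) := by
    intro u z
    have e := wNum_eq_wNum_one_mul_exp F γ b₀ p₀ j Ts hjTs ρ ρ' hρpos hθ hχsupp Φ J (1 - u) V z
    rwa [sub_sub_cancel] at e
  have hp10 : ∀ z, wNum F γ b₀ p₀ j Ts ρ ρ' Φ J 1 V z = wNum F γ b₀ p₀ j Ts ρ ρ' Φ J 0 V z * Real.exp (h z) := by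
    intro z; have e := hpt0 1 z; rwa [one_mul] at e
  have hp01 : ∀ z, wNum F γ b₀ p₀ j Ts ρ ρ' Φ J 0 V z = wNum F γ b₀ p₀ j Ts ρ ρ' Φ J 1 V z * Real.exp (-h z) := by
    intro z; have e := hpt1 1 z; rwa [sub_self, one_mul] at e
  -- quotients of `wNum_s`-integrals are `wgt_s`-integrals
  have hQ : ∀ (s : ℝ) (g : Z → ℝ), (∫ z, wNum F γ b₀ p₀ j Ts ρ ρ' Φ J s V z * g z ∂τ) / (∫ z, wNum F γ b₀ p₀ j Ts ρ ρ' Φ J s V z ∂τ)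
      = ∫ z, wgt F γ b₀ p₀ j Ts ρ ρ' τ Φ J s V z * g z ∂τ := by
    intro s g
    simp only [wgt]
    rw [← integral_div]
    refine integral_congr_ae (Eventually.of_forall fun z => ?_)
    simp only []
    ring
  -- measurability of `h` and of the weights
  have hΦm1 : Measurable fun z => Φ (V, z) := hΦm.comp (measurable_const.prodMk measurable_id)
  have hJm1 : Measurable fun z => (J (V, z) : ℝ) := (hJm.comp (measurable_const.prodMk measurable_id)).coe_nnreal_real
  have hmh : Measurable h := (Real.measurable_log.comp (hρm.comp hΦm1)).sub (Real.measurable_log.comp (hρ'm.comp hΦm1))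
  have hwm : ∀ s : ℝ, Measurable fun z => wNum F γ b₀ p₀ j Ts ρ ρ' Φ J s V z := by
    intro s
    have e : (fun z => wNum F γ b₀ p₀ j Ts ρ ρ' Φ J s V z)
        = fun z => mwCut F γ b₀ p₀ j Ts (Φ (V, z)) * (ρ Ts (Φ (V, z)) ^ s * ρ' Ts (Φ (V, z)) ^ (1 - s)) * (J (V, z) : ℝ) := by
      funext z; simp only [wNum, Real.rpow_eq_pow]
    rw [e]
    exact ((hχc.measurable.comp hΦm1).mul (((hρm.comp hΦm1).pow_const s).mul ((hρ'm.comp hΦm1).pow_const (1 - s)))).mul hJm1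
  -- `h` is bounded on the χ-support (continuity of `log ρ − log ρ′` on the compact `24∕25`-window inside the open `θ_Ts`-window)
  set C : Set (GaugeField (F.P Ts) 0 ↥(Matrix.specialUnitaryGroup (Fin 2) ℂ)) :=
    {U | ∀ p, dist1 (GaugeField.plaqHol U p) ≤ 24 / 25 * θBal F.L γ b₀ p₀ Ts} with hC
  have hCclosed : IsClosed C := by
    have : C = ⋂ p, {U | dist1 (GaugeField.plaqHol U p) ≤ 24 / 25 * θBal F.L γ b₀ p₀ Ts} := by
      ext U; simp only [hC, Set.mem_setOf_eq, Set.mem_iInter]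
    rw [this]
    exact isClosed_iInter fun p => isClosed_le ((continuous_dist1_SU (N := 2)).comp (continuous_plaqHol_SU (N := 2) p)) continuous_const
  have hCO : C ⊆ {U | PlaqSmall (θBal F.L γ b₀ p₀ Ts) U} := by
    intro U hU p
    exact lt_of_le_of_lt (hU p) (by linarith)
  have hχC : ∀ U, mwCut F γ b₀ p₀ j Ts U ≠ 0 → U ∈ C := by
    intro U hU p
    have hp := hχsupp U hU Ts hjTs le_rfl p
    rw [T3DescentFibreTower.descendTo_self] at hp
    exact le_of_lt hp
  have hgc : ContinuousOn (fun U => Real.log (ρ Ts U) - Real.log (ρ' Ts U)) C :=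
    ((hρc.log fun U hU => (hρpos U hU).1.ne').sub (hρ'c.log fun U hU => (hρpos U hU).2.ne')).mono hCO
  obtain ⟨B, hB⟩ := hCclosed.isCompact.exists_bound_of_continuousOn hgc
  have hsupp : ∀ (s : ℝ) (z : Z), wNum F γ b₀ p₀ j Ts ρ ρ' Φ J s V z ≠ 0 → h z ∈ Set.Icc (-B) B := by
    intro s z hz
    have hχz : mwCut F γ b₀ p₀ j Ts (Φ (V, z)) ≠ 0 := by
      intro h0; apply hz; simp only [wNum, h0, zero_mul]
    have hb := hB _ (hχC _ hχz)
    rw [Real.norm_eq_abs] at hb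
    exact abs_le.1 hb
  -- FIRST GAP: base `wNum₀`, tilt `h`
  set w0 : Z → ℝ≥0 := fun z => (wNum F γ b₀ p₀ j Ts ρ ρ' Φ J 0 V z).toNNReal with hw0
  have hw0c : ∀ z, (w0 z : ℝ) = wNum F γ b₀ p₀ j Ts ρ ρ' Φ J 0 V z := fun z => Real.coe_toNNReal _ (hnn 0 V z)
  have hw0m : Measurable w0 := (hwm 0).real_toNNReal
  have hw0i : Integrable (fun z => (w0 z : ℝ)) τ := by simp_rw [hw0c]; exact hI0
  have hw0p : 0 < ∫ z, (w0 z : ℝ) ∂τ := by simp_rw [hw0c]; exact hP0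
  have hb0 : ∀ᵐ z ∂τ, w0 z ≠ 0 → h z ∈ Set.Icc (-B) B := by
    refine Eventually.of_forall fun z hz => hsupp 0 z ?_
    intro h0; apply hz
    apply NNReal.coe_injective
    rw [hw0c, h0]; rfl
  have hvar0 : ∀ u ∈ Set.Ioo (0 : ℝ) 1,
      (∫ z, (w0 z : ℝ) * Real.exp (u * h z) *
          (h z - (∫ x, (w0 x : ℝ) * Real.exp (u * h x) * h x ∂τ) / ∫ x, (w0 x : ℝ) * Real.exp (u * h x) ∂τ) ^ 2 ∂τ)
        / (∫ z, (w0 z : ℝ) * Real.exp (u * h z) ∂τ) ≤ σ2 := by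
    intro u hu
    have e1 : ∀ z, (w0 z : ℝ) * Real.exp (u * h z) = wNum F γ b₀ p₀ j Ts ρ ρ' Φ J u V z := fun z => by rw [hw0c, ← hpt0]
    simp_rw [e1]
    rw [hQ u, hQ u]
    exact hvar u ⟨hu.1.le, hu.2.le⟩
  have hJ0 := weighted_jensenGap_nonneg_and_le τ hw0m hmh hb0 hw0i hw0p hvar0
  simp_rw [hw0c, ← hp10] at hJ0
  -- SECOND GAP: base `wNum₁`, tilt `−h` (its `u`-tilt is `ŵ_{1−u}`)
  set w1 : Z → ℝ≥0 := fun z => (wNum F γ b₀ p₀ j Ts ρ ρ' Φ J 1 V z).toNNReal with hw1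
  have hw1c : ∀ z, (w1 z : ℝ) = wNum F γ b₀ p₀ j Ts ρ ρ' Φ J 1 V z := fun z => Real.coe_toNNReal _ (hnn 1 V z)
  have hw1m : Measurable w1 := (hwm 1).real_toNNReal
  have hw1i : Integrable (fun z => (w1 z : ℝ)) τ := by simp_rw [hw1c]; exact hI1
  have hw1p : 0 < ∫ z, (w1 z : ℝ) ∂τ := by simp_rw [hw1c]; exact hP1
  have hmnh : Measurable fun z => -h z := hmh.neg
  have hb1 : ∀ᵐ z ∂τ, w1 z ≠ 0 → -h z ∈ Set.Icc (-B) B := by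
    refine Eventually.of_forall fun z hz => ?_
    have hz' : wNum F γ b₀ p₀ j Ts ρ ρ' Φ J 1 V z ≠ 0 := by
      intro h0; apply hz
      apply NNReal.coe_injective
      rw [hw1c, h0]; rfl
    have hb := hsupp 1 z hz'
    exact ⟨by linarith [hb.2], by linarith [hb.1]⟩
  have hvar1 : ∀ u ∈ Set.Ioo (0 : ℝ) 1,
      (∫ z, (w1 z : ℝ) * Real.exp (u * -h z) *
          (-h z - (∫ x, (w1 x : ℝ) * Real.exp (u * -h x) * -h x ∂τ) / ∫ x, (w1 x : ℝ) * Real.exp (u * -h x) ∂τ) ^ 2 ∂τ)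
        / (∫ z, (w1 z : ℝ) * Real.exp (u * -h z) ∂τ) ≤ σ2 := by
    intro u hu
    have e1 : ∀ z, (w1 z : ℝ) * Real.exp (u * -h z) = wNum F γ b₀ p₀ j Ts ρ ρ' Φ J (1 - u) V z := fun z => by rw [hw1c, ← hpt1]
    simp_rw [e1]
    rw [hQ (1 - u), hQ (1 - u)]
    have hm : ∫ x, wgt F γ b₀ p₀ j Ts ρ ρ' τ Φ J (1 - u) V x * -h x ∂τ = -∫ x, wgt F γ b₀ p₀ j Ts ρ ρ' τ Φ J (1 - u) V x * h x ∂τ := by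
      rw [← integral_neg]
      exact integral_congr_ae (Eventually.of_forall fun x => by simp only [mul_neg])
    rw [hm]
    have e2 : (fun z => wgt F γ b₀ p₀ j Ts ρ ρ' τ Φ J (1 - u) V z * (-h z - -∫ x, wgt F γ b₀ p₀ j Ts ρ ρ' τ Φ J (1 - u) V x * h x ∂τ) ^ 2)
        = fun z => wgt F γ b₀ p₀ j Ts ρ ρ' τ Φ J (1 - u) V z * (h z - ∫ x, wgt F γ b₀ p₀ j Ts ρ ρ' τ Φ J (1 - u) V x * h x ∂τ) ^ 2 := by
      funext z; ring
    rw [e2]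
    exact hvar (1 - u) ⟨by linarith [hu.2], by linarith [hu.1]⟩
  have hJ1 := weighted_jensenGap_nonneg_and_le τ hw1m hmnh hb1 hw1i hw1p hvar1
  have hm1 : ∫ z, wNum F γ b₀ p₀ j Ts ρ ρ' Φ J 1 V z * -h z ∂τ = -∫ z, wNum F γ b₀ p₀ j Ts ρ ρ' Φ J 1 V z * h z ∂τ := by
    rw [← integral_neg]
    exact integral_congr_ae (Eventually.of_forall fun z => by simp only [mul_neg])
  simp_rw [hw1c, Real.exp_neg] at hJ1
  simp_rw [← Real.exp_neg, ← hp01] at hJ1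
  rw [hm1, neg_div, sub_neg_eq_add] at hJ1
  -- the mean shift
  have hsum := gap_add_gap_eq_sub (∫ z, wNum F γ b₀ p₀ j Ts ρ ρ' Φ J 0 V z ∂τ) (∫ z, wNum F γ b₀ p₀ j Ts ρ ρ' Φ J 1 V z ∂τ)
    ((∫ z, wNum F γ b₀ p₀ j Ts ρ ρ' Φ J 0 V z * h z ∂τ) / ∫ z, wNum F γ b₀ p₀ j Ts ρ ρ' Φ J 0 V z ∂τ)
    ((∫ z, wNum F γ b₀ p₀ j Ts ρ ρ' Φ J 1 V z * h z ∂τ) / ∫ z, wNum F γ b₀ p₀ j Ts ρ ρ' Φ J 1 V z ∂τ)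
  have hshift : |(∫ z, wNum F γ b₀ p₀ j Ts ρ ρ' Φ J 1 V z * h z ∂τ) / (∫ z, wNum F γ b₀ p₀ j Ts ρ ρ' Φ J 1 V z ∂τ)
      - (∫ z, wNum F γ b₀ p₀ j Ts ρ ρ' Φ J 0 V z * h z ∂τ) / (∫ z, wNum F γ b₀ p₀ j Ts ρ ρ' Φ J 0 V z ∂τ)| ≤ σ2 := by
    rw [abs_le]
    constructor <;> linarith [hJ0.1, hJ0.2, hJ1.1, hJ1.2, hsum]
  exact setIntegral_wgt_le_of_endpointTails_meanShift F γ b₀ p₀ j Ts hjTs ρ ρ' hρm hρ'm hρc hρ'c hρpos hθ hχc hχ0 hχsupp hχpos τ Φ J hΦm hJm CJ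
    hJle hpos t ht0 ht1 V hV hA hES₀ htail₀ htail₁ hshift

end Summit.QuantumFields.YangMills.Theorems.OrganTangentGoodSetTailVariance

end
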